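import Summits.CriticalPhenomena.PercolationContinuityZ3.Theorems.Transplant.SkelPhiCylBall
import Summits.CriticalPhenomena.PercolationContinuityZ3.Theorems.Transplant.SkelWinLevels
import HarnessLib

/-!
# D″ node, STRUCTURE-FREE generic layer (SHEAR-SCOPE §3.14 ruling (B″), V98; DPRIME-SCOPE L5′): Kozma–Nitzan Lemma 10 over the
# WINDOW GRAPH of a bare planar map `φ : V → ℤ²` — the planar window levels `B⟨j⟩ = Win w₀ (Icc (lo − j) (hi + j)) R`, the level axioms,
# the boundary characterisations, Step II for window levels, and the window form of the probability transfer — φ-level re-cut of the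
# Φ-DEPENDENT declarations of `SkelTubeLevels` §2–§4 (p1-g7, p231058) and `SkelWinLevels` §1–§2 (p1-g7)

builds on p205010 (kernel theorem, internal audit signed; external expert review pending) — nothing in this file uses p205010.
Lane `prim-bschramm`, seat `prim-hp-8` (gen 29; V98 hp-8 column, claim 2026-08-21T03:48Z); helper file (`--supports stmt-CriticalPhenomena-4575`).
Every statement takes exactly the structure field it uses as a hypothesis, spelled through p3-g7's dictionary (`SkelPhiCylBall` §0):
`hlip : Skelφ.Lip G φ` for the Lipschitz step and the level nesting, `hΔ : ∀ v, G.degree v ≤ Δ` for Step II; so ONE layer serves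
`PlanarSkeletonConc` (node of record), `PlanarSkeletonNeg` / `PlanarSkeletonSign` (the D″ nodes) and the planar part of the rank-`m` skeletons.
Typed ONCE, instance-polymorphic (`[DecidableEq V]` section binder from §2 on, the lane convention p3-g4 2026-08-20 19:11:29Z (3); a classical
consumer infers its instance).  The Φ-FREE originals are IMPORTED, not re-declared: `Skel.winGraph` with its §1 (`winGraph_adj`, `winGraph_le`,
`degree_winGraph_le`, …), `Skel.lattW_winGraph_eq`, `Skel.real_eq_of_determinedBy_window` (`SkelTubeLevels`), all of `SkelTubeRestrict`
(`winRestrict`, `EdgeSupp`, `finSupp_winRestrict`), `SkelI.isSubbox_winRestrict(_lattW)` (`SkelWinLevels` §3).  Windows are `Skelφ.Win G φ w₀ P R`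
(`SkelPhiPrisms` §3).
* §1 **`φ_mem_Icc_enlarge_of_adj (hlip)`** (the Lipschitz step), `Win_subset_graphBall`, `Skelφ.winLevel G φ w₀ R lo hi j`, `mem_winLevel_iff`,
  `winLevel_zero`, `winLevel_subset_graphBall`, `winLevel_monotone`, `winLData` (+ `reachB_winLData`), `real_eq_of_determinedBy_Win`
  (window form of the transfer);
* §2 (`[DecidableEq V]`) `mem_outerBoundary_win_iff` / `mem_innerBoundary_win_iff` (structural), **`winLevel_nest (hlip)`**,
  `mem_sdiff_of_mem_outerBoundary_winLevel`, `mem_winLevel_succ_sdiff_iff`, `not_mem_innerBoundary_win_of_mem_Icc` (amendment (A));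
* §3 `lhyp_win (hlip)` (the generic `KNLevels.LHyp`), **`stepII_win (hlip) (hΔ)`**;
* §4 bridges (`rfl`): `PlanarSkeletonConc.Win_eq_skelφ`, `Skel.winLevel_eq_skelφ`, `Skel.winLData_eq_skelφ`.
[cite: KozmaNitzan2024, §4 Lemma 10, pp. 17–18 (Steps I–II), p. 15 (B⟨R⟩, ∂_ev B), p. 17 (subbox, ∂_iv D) — the ℤ^d model]
[cite: GrimmettPercolation1999, §7.2]
-/

noncomputable section

open MeasureTheory ProbabilityTheory
open scoped ENNReal

namespace Summit.CriticalPhenomena.PercolationContinuityZ3.Theorems.Transplant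

namespace Skelφ

open Literature.Probability.Percolation Literature.Probability.LatticeModels SimpleGraph
open Literature.Barriers.CriticalPhenomena (graphBall graphBall_finite mem_graphBall_self graphBall_mono)
open KNLevels Skel
open KozmaNitzan (wireSet_mono)
open scoped Classical

variable {V : Type} {G : SimpleGraph V} {φ : V → Site 2}

/-! ## §1 The Lipschitz step; the planar levels over the window of a bare planar map; level data; transfer -/

/-- **The Lipschitz step** (from `Lip`): along an edge of `G` the planar coordinate stays in the unit sup-norm neighbourhood, so a planar
box grows by one in each direction across an edge: `φ u ∈ Icc a b → G.Adj u v → φ v ∈ Icc (a - 1) (b + 1)`. [folklore] -/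
theorem φ_mem_Icc_enlarge_of_adj (hlip : Lip G φ) {a b : Site 2} {u v : V} (hu : φ u ∈ Finset.Icc a b) (huv : G.Adj u v) :
    φ v ∈ Finset.Icc (a - 1) (b + 1) := by
  rw [Finset.mem_Icc] at hu ⊢
  obtain ⟨ha, hb⟩ := hu
  constructor <;> intro i
  · have h1 := hlip huv i
    have h2 := ha i
    rw [abs_le] at h1
    simp only [Pi.sub_apply, Pi.one_apply]
    linarith [h1.1, h1.2]
  · have h1 := hlip huv i
    have h2 := hb i
    rw [abs_le] at h1
    simp only [Pi.add_apply, Pi.one_apply]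
    linarith [h1.1, h1.2]

variable (G φ) [G.LocallyFinite]

/-- Windows lie in the ball. [folklore] -/
theorem Win_subset_graphBall (w₀ : V) (P : Finset (Site 2)) (R : ℕ) : ↑(Win G φ w₀ P R) ⊆ graphBall G w₀ R :=
  fun _ hg => ((mem_Win G φ).1 (Finset.mem_coe.1 hg)).1

/-- **The window levels** `B⟨j⟩ := Win w₀ (Icc (lo - j) (hi + j)) R` of the planar map `φ`: KN's enlarged boxes in the plane, full depth
`R` in the fibre (φ-level form of `Skel.winLevel`). [this work] -/
def winLevel (w₀ : V) (R : ℕ) (lo hi : Site 2) (j : ℕ) : Finset V :=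
  Win G φ w₀ (Finset.Icc (lo - (j : Site 2)) (hi + (j : Site 2))) R

/-- Membership in a window level. [folklore] -/
theorem mem_winLevel_iff {w₀ : V} {R : ℕ} {lo hi : Site 2} {j : ℕ} {v : V} :
    v ∈ winLevel G φ w₀ R lo hi j ↔ v ∈ graphBall G w₀ R ∧ φ v ∈ Finset.Icc (lo - (j : Site 2)) (hi + (j : Site 2)) := by
  rw [winLevel, mem_Win]

/-- Level `0` is the window over `Icc lo hi`. [folklore] -/
theorem winLevel_zero (w₀ : V) (R : ℕ) (lo hi : Site 2) : winLevel G φ w₀ R lo hi 0 = Win G φ w₀ (Finset.Icc lo hi) R := by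
  simp [winLevel]

/-- Window levels lie in the ball. [folklore] -/
theorem winLevel_subset_graphBall (w₀ : V) (R : ℕ) (lo hi : Site 2) (j : ℕ) : ↑(winLevel G φ w₀ R lo hi j) ⊆ graphBall G w₀ R :=
  Win_subset_graphBall G φ w₀ _ R

/-- **Level axiom 1**: the window levels increase. [folklore] -/
theorem winLevel_monotone (w₀ : V) (R : ℕ) (lo hi : Site 2) : Monotone (winLevel G φ w₀ R lo hi) := by
  intro j j' h
  refine Win_mono G φ (Finset.Icc_subset_Icc (fun i => ?_) (fun i => ?_)) le_rfl <;>
    simp only [Pi.sub_apply, Pi.add_apply, Pi.natCast_apply] <;> omega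

/-- **The level data in the window graph** of the planar map `φ`: levels `winLevel G φ w₀ R lo hi`, source `o`, support `Sfin`
(φ-level form of `Skel.winLData`). [this work] -/
def winLData (w₀ : V) (R : ℕ) (lo hi : Site 2) (o : V) (Sfin : Finset V) : LData (winGraph G w₀ R) :=
  ⟨winLevel G φ w₀ R lo hi, o, Sfin⟩

/-- The levels of `winLData`. [folklore] -/
@[simp] theorem winLData_X (w₀ : V) (R : ℕ) (lo hi : Site 2) (o : V) (Sfin : Finset V) :
    (winLData G φ w₀ R lo hi o Sfin).X = winLevel G φ w₀ R lo hi := rfl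

/-- The source of `winLData`. [folklore] -/
@[simp] theorem winLData_o (w₀ : V) (R : ℕ) (lo hi : Site 2) (o : V) (Sfin : Finset V) :
    (winLData G φ w₀ R lo hi o Sfin).o = o := rfl

/-- The support of `winLData`. [folklore] -/
@[simp] theorem winLData_Sfin (w₀ : V) (R : ℕ) (lo hi : Site 2) (o : V) (Sfin : Finset V) :
    (winLData G φ w₀ R lo hi o Sfin).Sfin = Sfin := rfl

/-- `{o ↔ B}` for the window data is `{o ↔ Win w₀ (Icc lo hi) R}`. [folklore] -/
theorem reachB_winLData (w₀ : V) (R : ℕ) (lo hi : Site 2) (o : V) (Sfin : Finset V) :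
    (winLData G φ w₀ R lo hi o Sfin).reachB = ⋃ b ∈ Win G φ w₀ (Finset.Icc lo hi) R, openConn o b := by
  rw [LData.reachB, winLData_X, winLevel_zero]; rfl

/-- Window form of the transfer: an event determined by the pairs inside a window `Win w₀ P R` has the same probability under the window
graph and under `G` (φ-level form of `Skel.real_eq_of_determinedBy_Win`, from the Φ-free `Skel.real_eq_of_determinedBy_window`).
[cite: KozmaNitzan2024, §4 p. 17 ("the induced graph on D is isomorphic to …")] -/
theorem real_eq_of_determinedBy_Win {w₀ : V} {R : ℕ} {P : Finset (Site 2)} (p : unitInterval) {A : Set (BondConfig V)}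
    (hA : DeterminedBy A (wireSet (↑(Win G φ w₀ P R) : Set V))) (hAm : MeasurableSet A) :
    (bondPercolation (winGraph G w₀ R) p).real A = (bondPercolation G p).real A :=
  real_eq_of_determinedBy_window p (hA.mono (wireSet_mono (Win_subset_graphBall G φ w₀ P R))) hAm

/-! ## §2 Boundaries of windows and levels in the window graph; nesting; the annulus; amendment (A) -/

variable [DecidableEq V]

/-- **Outer boundary of a window in the window graph** (structural form): `x ∈ ∂^{out} Win w₀ P R` iff `x` lies in the ball, `φ x ∉ P`,
and `x` has a `G`-neighbour in the ball with planar coordinate in `P` (off-ball vertices are isolated in the window graph).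
[cite: KozmaNitzan2024, §4 p. 15 (∂_ev B)] -/
theorem mem_outerBoundary_win_iff {w₀ : V} {R : ℕ} {P : Finset (Site 2)} {x : V} :
    x ∈ outerBoundary (winGraph G w₀ R) (Win G φ w₀ P R) ↔
      x ∈ graphBall G w₀ R ∧ φ x ∉ P ∧ ∃ y, G.Adj x y ∧ y ∈ graphBall G w₀ R ∧ φ y ∈ P := by
  rw [mem_outerBoundary_iff]
  constructor
  · rintro ⟨hx, y, hy, hxy⟩
    rw [mem_Win] at hy
    obtain ⟨hadj, hx1, hy1⟩ := (winGraph_adj G).1 hxy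
    exact ⟨hx1, fun h => hx ((mem_Win G φ).2 ⟨hx1, h⟩), y, hadj, hy1, hy.2⟩
  · rintro ⟨hx1, hxP, y, hxy, hy1, hyP⟩
    exact ⟨fun h => hxP ((mem_Win G φ).1 h).2, y, (mem_Win G φ).2 ⟨hy1, hyP⟩, (winGraph_adj G).2 ⟨hxy, hx1, hy1⟩⟩

/-- **Inner boundary of a window in the window graph** (structural form): `v ∈ ∂^{in} Win w₀ P R` iff `v ∈ Win w₀ P R` and `v` has a
`G`-neighbour IN THE BALL whose planar coordinate is outside `P` (macro contacts only: the ends of the ball are invisible in the window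
graph — amendment (A)). [cite: KozmaNitzan2024, §4 p. 17 (∂_iv D)] -/
theorem mem_innerBoundary_win_iff {w₀ : V} {R : ℕ} {P : Finset (Site 2)} {v : V} :
    v ∈ innerBoundary (winGraph G w₀ R) (Win G φ w₀ P R) ↔
      (v ∈ graphBall G w₀ R ∧ φ v ∈ P) ∧ ∃ y, G.Adj v y ∧ y ∈ graphBall G w₀ R ∧ φ y ∉ P := by
  rw [mem_innerBoundary_iff, mem_Win]
  constructor
  · rintro ⟨hv, y, hy, hvy⟩
    obtain ⟨hadj, -, hy1⟩ := (winGraph_adj G).1 hvy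
    exact ⟨hv, y, hadj, hy1, fun h => hy ((mem_Win G φ).2 ⟨hy1, h⟩)⟩
  · rintro ⟨hv, y, hvy, hy1, hyP⟩
    exact ⟨hv, y, fun h => hyP ((mem_Win G φ).1 h).2, (winGraph_adj G).2 ⟨hvy, hv.1, hy1⟩⟩

variable {G φ}

/-- **Level axiom 2** (from `Lip`): the outer boundary (in the window graph) of `B⟨j⟩` lies in `B⟨j+1⟩` — by the Lipschitz step.
[cite: KozmaNitzan2024, §4 p. 15 (∂_ev B ⊆ B⟨1⟩)] -/
theorem winLevel_nest (hlip : Lip G φ) (w₀ : V) (R : ℕ) (lo hi : Site 2) (j : ℕ) :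
    outerBoundary (winGraph G w₀ R) (winLevel G φ w₀ R lo hi j) ⊆ winLevel G φ w₀ R lo hi (j + 1) := by
  intro x hx
  obtain ⟨hx1, -, y, hxy, -, hyP⟩ := (mem_outerBoundary_win_iff G φ).1 hx
  rw [mem_winLevel_iff]
  refine ⟨hx1, ?_⟩
  have h := φ_mem_Icc_enlarge_of_adj hlip hyP hxy.symm
  refine Finset.Icc_subset_Icc (fun i => ?_) (fun i => ?_) h <;>
    simp only [Pi.sub_apply, Pi.add_apply, Pi.natCast_apply, Pi.one_apply] <;> push_cast <;> omega

/-- A contact vertex of level `j` (outer boundary in the window graph) lies in the planar ANNULUS `B⟨j+1⟩ ∖ B⟨j⟩` over the ball.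
[cite: KozmaNitzan2024, §4 p. 15 (∂_ev B)] -/
theorem mem_sdiff_of_mem_outerBoundary_winLevel (hlip : Lip G φ) {w₀ : V} {R : ℕ} {lo hi : Site 2} {j : ℕ} {x : V}
    (hx : x ∈ outerBoundary (winGraph G w₀ R) (winLevel G φ w₀ R lo hi j)) :
    x ∈ winLevel G φ w₀ R lo hi (j + 1) \ winLevel G φ w₀ R lo hi j :=
  Finset.mem_sdiff.2 ⟨winLevel_nest hlip w₀ R lo hi j hx, (mem_outerBoundary_iff.1 hx).1⟩

variable (G φ)

/-- The planar ANNULUS `B⟨j+1⟩ ∖ B⟨j⟩` over the ball, coordinate form (for the seed kits). [folklore] -/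
theorem mem_winLevel_succ_sdiff_iff {w₀ : V} {R : ℕ} {lo hi : Site 2} {j : ℕ} {x : V} :
    x ∈ winLevel G φ w₀ R lo hi (j + 1) \ winLevel G φ w₀ R lo hi j ↔
      x ∈ graphBall G w₀ R ∧ φ x ∈ Finset.Icc (lo - ((j + 1 : ℕ) : Site 2)) (hi + ((j + 1 : ℕ) : Site 2)) ∧
        φ x ∉ Finset.Icc (lo - (j : Site 2)) (hi + (j : Site 2)) := by
  rw [Finset.mem_sdiff, mem_winLevel_iff, mem_winLevel_iff]
  tauto

variable {G φ}

/-- **Amendment (A), generic form** (from `Lip`): a window vertex whose planar coordinate lies in the SHRUNK box `Icc (lo + 1) (hi - 1)` is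
not an inner-boundary vertex of `Win w₀ (Icc lo hi) R` in the window graph (all its window-graph neighbours have `φ ∈ Icc lo hi` by the
Lipschitz step; the ends of the ball carry no window-graph edges). [cite: KozmaNitzan2024, §4 p. 17 (∂_iv D)] -/
theorem not_mem_innerBoundary_win_of_mem_Icc (hlip : Lip G φ) {w₀ : V} {R : ℕ} {lo hi : Site 2} {v : V}
    (hv : φ v ∈ Finset.Icc (lo + 1) (hi - 1)) : v ∉ innerBoundary (winGraph G w₀ R) (Win G φ w₀ (Finset.Icc lo hi) R) := by
  intro h
  obtain ⟨-, y, hvy, -, hyP⟩ := (mem_innerBoundary_win_iff G φ).1 h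
  refine hyP ?_
  have h1 := φ_mem_Icc_enlarge_of_adj hlip hv hvy
  refine Finset.Icc_subset_Icc (fun i => ?_) (fun i => ?_) h1 <;>
    simp only [Pi.sub_apply, Pi.add_apply, Pi.one_apply] <;> omega

/-! ## §3 The hypotheses of Lemma 10 and Step II for window levels -/

/-- **The hypotheses of Lemma 10 for window levels** (from `Lip`): a subbox `D ⊇ B⟨Rl+1⟩` (in the window graph) of a finitely supported
weighting at parameter `p` and a source `o ∈ Sfin \ D` give `KNLevels.LHyp`. [cite: KozmaNitzan2024, §4 Lemma 10 (p. 17)] -/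
theorem lhyp_win (hlip : Lip G φ) (w₀ : V) (R : ℕ) (lo hi : Site 2) {o : V} {Sfin D : Finset V} {Wt : Sym2 V → unitInterval}
    {p : unitInterval} {Rl : ℕ} (hsub : IsSubbox (winGraph G w₀ R) Wt p D) (hfin : FinSupp Wt Sfin) (hDS : D ⊆ Sfin)
    (hencl : winLevel G φ w₀ R lo hi (Rl + 1) ⊆ D) (ho : o ∉ D) (hoS : o ∈ Sfin) :
    LHyp (winLData G φ w₀ R lo hi o Sfin) Wt p D Rl where
  mono := winLevel_monotone G φ w₀ R lo hi
  nest := winLevel_nest hlip w₀ R lo hi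
  sub := hsub
  fin := hfin
  DS := hDS
  encl := hencl
  o_not := ho
  o_mem := hoS

/-- **Kozma–Nitzan's Step II over the window levels of a planar map** (from `Lip` and the degree bound `Δ`; countably many vertices):
for a finitely supported weighting `Wt` with a subbox `D ⊇ B⟨Rl+1⟩` in the window graph at depth `R` about `w₀`, at parameter `p < 1`, and a
source `o ∈ Sfin \ D`, if `P_Wt(o ↔ Win w₀ (Icc lo hi) R) > 1 - δ` and the level range `[j₀, j₁]`, `j₁ ≤ Rl`, has at least
`(1-p)^{-Δ N}/δ` levels, then at some level `j` there are at least `N` (macro) contact vertices joined to `o` outside `B⟨j⟩` with probability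
`> 1 - 2δ` (φ-level form of `Skel.stepII_win` / `SkelI.stepII_win`). [cite: KozmaNitzan2024, §4 p. 18 (Step II)] -/
theorem stepII_win [Countable V] (hlip : Lip G φ) {Δ : ℕ} (hΔ : ∀ v, G.degree v ≤ Δ) (w₀ : V) (R : ℕ) (lo hi : Site 2) {o : V}
    {Sfin D : Finset V} {Wt : Sym2 V → unitInterval} {p : unitInterval} {Rl : ℕ}
    (hsub : IsSubbox (winGraph G w₀ R) Wt p D) (hfin : FinSupp Wt Sfin) (hDS : D ⊆ Sfin)
    (hencl : winLevel G φ w₀ R lo hi (Rl + 1) ⊆ D) (ho : o ∉ D) (hoS : o ∈ Sfin)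
    (hp1 : (p : ℝ) < 1) {N j₀ j₁ : ℕ} (hj₁ : j₁ ≤ Rl) {δ : ℝ}
    (hJ : 1 / (1 - (p : ℝ)) ^ (Δ * N) ≤ δ * ((Finset.Icc j₀ j₁).card : ℝ))
    (hreach : 1 - δ < (prodBernoulli Wt).real (⋃ b ∈ Win G φ w₀ (Finset.Icc lo hi) R, openConn o b)) :
    ∃ j ∈ Finset.Icc j₀ j₁, 1 - 2 * δ < (prodBernoulli Wt).real {ω | N ≤ ((winLData G φ w₀ R lo hi o Sfin).Kont j ω).card} := by
  have hL := lhyp_win hlip w₀ R lo hi hsub hfin hDS hencl ho hoS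
  rw [← reachB_winLData G φ w₀ R lo hi o Sfin] at hreach
  exact hL.stepII (degree_winGraph_le G hΔ w₀ R) hp1 hj₁ hJ hreach

end Skelφ

/-! ## §4 Bridges: the structure-level windows and levels are the φ-level ones (by `rfl`) -/

namespace PlanarSkeletonConc

open Literature.Probability.LatticeModels

variable {V : Type} {G : SimpleGraph V} [G.LocallyFinite] (Φ : PlanarSkeletonConc G)

/-- `PlanarSkeletonConc.Win` is the φ-level window of `Φ.φ`. [folklore] -/
theorem Win_eq_skelφ (w₀ : V) (P : Finset (Site 2)) (R : ℕ) : Φ.Win w₀ P R = Skelφ.Win G Φ.φ w₀ P R := rfl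

end PlanarSkeletonConc

namespace Skel

open Literature.Probability.LatticeModels

variable {V : Type} {G : SimpleGraph V} [G.LocallyFinite] (Φ : PlanarSkeletonConc G)

/-- `Skel.winLevel` is the φ-level window level of `Φ.φ`. [folklore] -/
theorem winLevel_eq_skelφ (w₀ : V) (R : ℕ) (lo hi : Site 2) (j : ℕ) :
    winLevel Φ w₀ R lo hi j = Skelφ.winLevel G Φ.φ w₀ R lo hi j := rfl

/-- `Skel.winLData` is the φ-level level data of `Φ.φ`. [folklore] -/
theorem winLData_eq_skelφ (w₀ : V) (R : ℕ) (lo hi : Site 2) (o : V) (Sfin : Finset V) :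
    winLData Φ w₀ R lo hi o Sfin = Skelφ.winLData G Φ.φ w₀ R lo hi o Sfin := rfl

end Skel

end Summit.CriticalPhenomena.PercolationContinuityZ3.Theorems.Transplant

end
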